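import Summits.ABC.ABC.Theorems.TamagawaTwistDictionaryTamagawaTwistPayoffTwistConductor
import Summits.ABC.ABC.Theorems.TamagawaTwistDictionaryTamagawaTwistPayoffTamagawaLower
import Literature.NumberTheory.EllipticCurves.PastenValuationProduct
import Mathlib.Analysis.SpecialFunctions.Pow.Real
import HarnessLib

/-!
# Route `TamagawaTwistDictionary`, crux `TamagawaTwistPayoff` (stmt-ABC-24114) — helper:
# the `j`-pole towers under Pasten's Conjecture 1.14

Two statements about a place `v` with `ord_v(j_E) = −ν < 0` of an elliptic curve `E/ℚ`:

* `ordMinimalDiscriminant_le_jPole_add` — UNCONDITIONALLY `ord_v(Δ_min E) ≤ ν + 18`: at a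
  multiplicative place `ord_v(Δ_min) = ν` (Silverman AEC VII.5.1 (b)); at an odd additive
  (potentially multiplicative) place the twist by `p* = ±p` is multiplicative and costs `6`
  (tree `SingleTowerSzpiroLine.conductorExponent_twistModel_pstar_eq_one`,
  `…ordMinimalDiscriminant_le_twist_add_six`, Silverman ATAEC IV.9.4 Step 7); at `2` the Tate form
  cases `d ≡ 1, 3, 2 (mod 4)` give `ν, ν + 12, ν + 18` (tree
  `WeierstrassCurve.kodairaSymbolAt_and_ordMinimalDiscriminant_of_emod_four_eq_three/two`,
  Kraus 1989 Prop. 2).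
* `jPole_le_of_smallTamagawa` — under `SmallTamagawaConjecture` (Pasten, JNT 254 (2024),
  Conj. 1.14: `Tam(E) < K_ε N_E^ε` for all `E/ℚ`), for every `ε > 0` there is `K` with
  `ν ≤ K · N_E^{17ε}` at every `j`-pole place of every `E/ℚ`: apply the conjecture to the small
  split twist `E'` of the sibling file `…TwistConductor` (`ν = c_v(E') ≤ Tam(E')`,
  `N_{E'} ≤ N_E (2d)^8 ≤ 8^8 N_E^{17}`).

Together: the TOWER at a `j`-pole place is `≤ (K N_E^{17ε} + 18) · log p`, the «twist
dictionary» half of Pasten's unproved remark «Conjecture 1.14 implies `log Δ_E ≪_ε N_E^ε`»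
(JNT 254 (2024), after Thm 1.15).

HONESTY: the second statement is CONDITIONAL on Conj. 1.14 (an explicit hypothesis, the tree's
`Literature.NumberTheory.EllipticCurves.SmallTamagawaConjecture`, OPEN); nothing here is abc,
A-PS or A1′. No `sorry`, no new axiom, no `def`.

References: H. Pasten, J. Number Theory 254 (2024) = arXiv:1705.09251, Conj. 1.14 and the remark
after Thm 1.15; J. H. Silverman, *AEC* (2009) VII.5.1; *ATAEC* (1994) IV.9.4, IV.10; A. Kraus,
Acta Arith. 54 (1989) Prop. 2.
-/

noncomputable section

-- `Summit.<Summit>.<Problem>` is the mandated summit-side namespace (CONVENTIONS §2); for the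
-- single-conjunct summit `ABC` the two coincide, so the duplicate `ABC.ABC` is deliberate.
set_option linter.dupNamespace false

namespace Summit.ABC.ABC.Theorems.TamagawaTwistPayoffLine

open scoped NumberField
open IsDedekindDomain WeierstrassCurve Rat.HeightOneSpectrum Literature.NumberTheory.EllipticCurves
open Summit.ABC.ABC.Theorems.SingleTowerSzpiroLine

/-! ### `ord_v(Δ_min) ≤ ν + 18` at a `j`-pole place -/

/-- **`ord_v(Δ_min E) ≤ −ord_v(j_E) + 18` at every place with `ord_v(j_E) < 0`** (unconditional).
Here `v` is a place of `ℤ`, `v'` the place of `𝓞 ℚ` over the same prime, `|j_E|_{v'} = exp(ν)`.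
Multiplicative places: equality with `ν` (AEC VII.5.1 (b)); odd additive places: the twist by
`p*` is multiplicative, `+6` (ATAEC IV.9.4 Step 7); the place `2`: Tate-form cases, `+12`/`+18`
(Kraus 1989 Prop. 2). [cite: SilvermanATAEC1994, IV.9.4 Step 7 and Table 4.1]
[cite: Kraus1989, Prop. 2] -/
theorem ordMinimalDiscriminant_le_jPole_add (E : WeierstrassCurve ℚ) [E.IsElliptic]
    (v : HeightOneSpectrum ℤ) (v' : HeightOneSpectrum (𝓞 ℚ)) (hvv' : natGenerator v = natGenerator v')
    (hj' : 1 < v'.valuation ℚ E.j) {ν : ℕ} (hν : v'.valuation ℚ E.j = WithZero.exp (ν : ℤ)) :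
    E.ordMinimalDiscriminant v ≤ ν + 18 := by
  have hpv : (primesEquiv v : Nat.Primes) = primesEquiv v' := Subtype.ext hvv'
  have hj : 1 < v.valuation ℚ E.j := (one_lt_valuation_iff_of_natGenerator_eq v v' hvv' E.j).mpr hj'
  have hordvv' : E.ordMinimalDiscriminant v = E.ordMinimalDiscriminant v' :=
    ordMinimalDiscriminant_eq_of_natGenerator_eq E v v' hvv'
  -- a curve with the same `j`, multiplicative at `v'`, has `ord_{v'}(Δ_min) = ν`
  have key : ∀ (X : WeierstrassCurve ℚ) [X.IsElliptic], X.j = E.j →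
      X.HasMultiplicativeReductionAt v' → X.ordMinimalDiscriminant v' = ν := by
    intro X _ hXj hm
    have h := X.valuation_j_eq_exp_ordMinimalDiscriminant_of_hasMultiplicativeReductionAt v' hm
    rw [hXj, hν] at h
    have := WithZero.exp_injective h
    omega
  by_cases hp : natGenerator v = 2
  · -- the place `2`: Tate-form cases
    have hv' : natGenerator v' = 2 := hvv' ▸ hp
    obtain ⟨hj0, hj1728, -⟩ := E.j_ne_and_valuation_j_sub_eq_of_one_lt_valuation_j v' hj'
    obtain ⟨d, -, hd4, C, hC⟩ := E.exists_int_variableChange_eq_quadraticTwist_tateFormOfJ hj0 hj1728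
    have hcases : d % 4 = 1 ∨ d % 4 = 3 ∨ d % 4 = 2 := by omega
    rcases hcases with h1 | h3 | h2
    · have hmult := WeierstrassCurve.hasMultiplicativeReductionAt_of_emod_four_eq_one v' hv' E hj' h1 hC
      rw [hordvv', key E rfl hmult]; omega
    · rw [hordvv', (WeierstrassCurve.kodairaSymbolAt_and_ordMinimalDiscriminant_of_emod_four_eq_three
        v' hv' E hj' hν h3 hC).2]; omega
    · rw [hordvv', (WeierstrassCurve.kodairaSymbolAt_and_ordMinimalDiscriminant_of_emod_four_eq_two
        v' hv' E hj' hν h2 hC).2]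
  · -- an odd place
    have hpp : (natGenerator v).Prime := prime_natGenerator v
    by_cases hf : E.conductorExponent v = 1
    · -- multiplicative
      have hf' : E.conductorExponent v' = 1 := by
        rw [← WeierstrassCurve.conductorExponent_eq_of_primesEquiv_eq v v' E hpv]; exact hf
      have hmult : E.HasMultiplicativeReductionAt v' :=
        (WeierstrassCurve.conductorExponent_eq_one_iff_holds v' E).mp hf'
      rw [hordvv', key E rfl hmult]; omega
    · -- additive, potentially multiplicative: twist by `p*`
      obtain ⟨s, k, hs, hk⟩ := exists_sign_four_mul_add_one hpp hp
      have hkq : 4 * (k : ℚ) + 1 = (s : ℚ) * (natGenerator v : ℚ) := by exact_mod_cast hk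
      have hsp0 : (s : ℚ) * (natGenerator v : ℚ) ≠ 0 :=
        mul_ne_zero (by rcases hs with rfl | rfl <;> simp) (by exact_mod_cast hpp.ne_zero)
      haveI hE₁ : (E.twistModel (k : ℚ)).IsElliptic :=
        ⟨by rw [twistModel_Δ]; exact (IsUnit.mk0 _ (pow_ne_zero 6 (by rw [hkq]; exact hsp0))).mul E.isUnit_Δ⟩
      have hf₁ : (E.twistModel (k : ℚ)).conductorExponent v = 1 :=
        conductorExponent_twistModel_pstar_eq_one v hp E hf hj hs hk
      have hord : E.ordMinimalDiscriminant v ≤ (E.twistModel (k : ℚ)).ordMinimalDiscriminant v + 6 :=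
        ordMinimalDiscriminant_le_twist_add_six v E hs hk
      have hf₁' : (E.twistModel (k : ℚ)).conductorExponent v' = 1 := by
        rw [← WeierstrassCurve.conductorExponent_eq_of_primesEquiv_eq v v' _ hpv]; exact hf₁
      have hmult : (E.twistModel (k : ℚ)).HasMultiplicativeReductionAt v' :=
        (WeierstrassCurve.conductorExponent_eq_one_iff_holds v' _).mp hf₁'
      have hν₁ : (E.twistModel (k : ℚ)).ordMinimalDiscriminant v' = ν := key _ (j_twistModel E (k : ℚ)) hmult
      have h₁ : (E.twistModel (k : ℚ)).ordMinimalDiscriminant v = ν := by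
        rw [ordMinimalDiscriminant_eq_of_natGenerator_eq _ v v' hvv', hν₁]
      omega

/-! ### The `j`-pole under Conjecture 1.14 -/

/-- **Conj. 1.14 bounds the pole order of `j`.** Under Pasten's Conjecture 1.14
(`SmallTamagawaConjecture`), for every `ε > 0` there is `K ≥ 0` such that for every elliptic
`E/ℚ` and every place `v` of `𝓞 ℚ` with `|j_E|_v = exp(ν)`, `ν ≥ 1`:  `ν ≤ K · N_E^{17ε}`.
Proof: the small split twist `E'` of `exists_split_partner` has `ν = c_v(E') ≤ Tam(E')
< K₀ N_{E'}^ε` and `N_{E'} ≤ N_E (2d)^8 ≤ 8^8 N_E^{17}` (`d < 4p²`, `p ∣ N_E`). CONDITIONAL on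
Conj. 1.14. [cite: PastenShimura2024, Conjecture 1.14 and the remark following Theorem 1.15] -/
theorem jPole_le_of_smallTamagawa (hT : Literature.NumberTheory.EllipticCurves.SmallTamagawaConjecture)
    {ε : ℝ} (hε : 0 < ε) :
    ∃ K : ℝ, 0 ≤ K ∧ ∀ (E : WeierstrassCurve ℚ) [E.IsElliptic] (v' : HeightOneSpectrum (𝓞 ℚ)),
      1 < v'.valuation ℚ E.j → ∀ ν : ℕ, v'.valuation ℚ E.j = WithZero.exp (ν : ℤ) →
        (ν : ℝ) ≤ K * (E.conductorNorm ℤ : ℝ) ^ (17 * ε) := by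
  obtain ⟨K₀, hK₀⟩ := hT ε hε
  refine ⟨max K₀ 0 * ((8 : ℝ) ^ 8) ^ ε, by positivity, fun E _ v' hj' ν hν => ?_⟩
  obtain ⟨E', hE', d, hd0, hdlt, hjE', hsplit, hdvd⟩ := exists_split_partner E v' hj'
  haveI := hE'
  -- `ν ≤ Tam(E') < K₀ N_{E'}^ε`
  have hνle : ν ≤ E'.tamagawaProduct :=
    jPole_le_tamagawaProduct E' v' hsplit (by rw [hjE']; exact hν)
  have hTam : (E'.tamagawaProduct : ℝ) < K₀ * (E'.conductorNorm ℤ : ℝ) ^ ε := hK₀ E'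
  -- `p ∣ N_E`, through the place of `ℤ` over `p`
  set p : ℕ := natGenerator v' with hpdef
  set v : HeightOneSpectrum ℤ := (primesEquiv (R := ℤ)).symm (primesEquiv v') with hvdef
  have hvv' : natGenerator v = natGenerator v' :=
    Literature.NumberTheory.EllipticCurves.Rat.natGenerator_primesEquiv_symm (primesEquiv v')
  have hj : 1 < v.valuation ℚ E.j := (one_lt_valuation_iff_of_natGenerator_eq v v' hvv' E.j).mpr hj'
  have hf : E.conductorExponent v ≠ 0 := conductorExponent_ne_zero_of_one_lt_valuation_j v E hj
  have hN : 0 < E.conductorNorm ℤ := conductorNorm_pos_holds E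
  have hpN : p ≤ E.conductorNorm ℤ := by
    refine Nat.le_of_dvd hN (Nat.dvd_of_factorization_pos ?_)
    rw [hpdef, ← hvv', WeierstrassCurve.factorization_conductorNorm_holds E v]
    exact hf
  -- `N_{E'} ≤ 8^8 N_E^17`
  have hN' : 0 < E'.conductorNorm ℤ := conductorNorm_pos_holds E'
  have hN'le : E'.conductorNorm ℤ ≤ 8 ^ 8 * E.conductorNorm ℤ ^ 17 := by
    have h1 : E'.conductorNorm ℤ ≤ E.conductorNorm ℤ * (2 * d) ^ 8 :=
      Nat.le_of_dvd (Nat.mul_pos hN (pow_pos (by omega) _)) hdvd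
    have h2 : 2 * d ≤ 8 * p ^ 2 := by linarith [hdlt]
    have h3 : 8 * p ^ 2 ≤ 8 * E.conductorNorm ℤ ^ 2 :=
      Nat.mul_le_mul_left 8 (Nat.pow_le_pow_left hpN 2)
    have h4 : (2 * d) ^ 8 ≤ (8 * E.conductorNorm ℤ ^ 2) ^ 8 := Nat.pow_le_pow_left (h2.trans h3) 8
    calc E'.conductorNorm ℤ ≤ E.conductorNorm ℤ * (2 * d) ^ 8 := h1
      _ ≤ E.conductorNorm ℤ * (8 * E.conductorNorm ℤ ^ 2) ^ 8 := Nat.mul_le_mul_left _ h4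
      _ = 8 ^ 8 * E.conductorNorm ℤ ^ 17 := by ring
  -- real-number bookkeeping
  have hNR : (0 : ℝ) ≤ (E.conductorNorm ℤ : ℝ) := by positivity
  have hN'R : (0 : ℝ) ≤ (E'.conductorNorm ℤ : ℝ) := by positivity
  have hN'leR : (E'.conductorNorm ℤ : ℝ) ≤ (8 : ℝ) ^ 8 * (E.conductorNorm ℤ : ℝ) ^ 17 := by
    exact_mod_cast hN'le
  have hrpow : (E'.conductorNorm ℤ : ℝ) ^ ε ≤ ((8 : ℝ) ^ 8) ^ ε * (E.conductorNorm ℤ : ℝ) ^ (17 * ε) := by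
    calc (E'.conductorNorm ℤ : ℝ) ^ ε ≤ ((8 : ℝ) ^ 8 * (E.conductorNorm ℤ : ℝ) ^ 17) ^ ε :=
          Real.rpow_le_rpow hN'R hN'leR hε.le
      _ = ((8 : ℝ) ^ 8) ^ ε * ((E.conductorNorm ℤ : ℝ) ^ 17) ^ ε :=
          Real.mul_rpow (by positivity) (by positivity)
      _ = ((8 : ℝ) ^ 8) ^ ε * (E.conductorNorm ℤ : ℝ) ^ (17 * ε) := by
          congr 1
          rw [← Real.rpow_natCast _ 17, ← Real.rpow_mul hNR]
          norm_num
  have hK₀le : K₀ * (E'.conductorNorm ℤ : ℝ) ^ ε ≤ max K₀ 0 * (E'.conductorNorm ℤ : ℝ) ^ ε :=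
    mul_le_mul_of_nonneg_right (le_max_left _ _) (by positivity)
  calc (ν : ℝ) ≤ (E'.tamagawaProduct : ℝ) := by exact_mod_cast hνle
    _ ≤ K₀ * (E'.conductorNorm ℤ : ℝ) ^ ε := hTam.le
    _ ≤ max K₀ 0 * (E'.conductorNorm ℤ : ℝ) ^ ε := hK₀le
    _ ≤ max K₀ 0 * (((8 : ℝ) ^ 8) ^ ε * (E.conductorNorm ℤ : ℝ) ^ (17 * ε)) :=
        mul_le_mul_of_nonneg_left hrpow (le_max_right _ _)
    _ = max K₀ 0 * ((8 : ℝ) ^ 8) ^ ε * (E.conductorNorm ℤ : ℝ) ^ (17 * ε) := by ring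

end Summit.ABC.ABC.Theorems.TamagawaTwistPayoffLine

end
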